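import Literature.Analysis.InnerProduct.HigherLensSpaceMultiplicityInvariance
import Mathlib.Algebra.BigOperators.ModEq
import HarnessLib

/-!
# Ikeda's homotopy criterion for lens spaces is an equivalence relation, implied by the isometry criterion (Ikeda 1980,
# Theorems 2.1–2.2)

Layer `Literature/Analysis/InnerProduct`, namespace `Literature.Analysis.InnerProduct`; lane `lit-hodgefound`, prover seat
`lit-hodgefound-p06`, generation 45, row g45-#9. THEOREMS only (no definition, no instance, no notation, no named fact).
Companion of `LensWeightsEquivalenceRelation.lean` (row g45-#8).

## Source, verbatim (held text `paper:doi-10-24033-asens-1384`)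

A. Ikeda, *On lens spaces which are isospectral but not isometric*, Ann. Sci. ÉNS (4) 13 (1980) 303–315, §2: "**Theorem 2.1.**
Let `L = L(q : p₁, …, p_n)` and `L' = L(q : s₁, …, s_n)` be lens spaces. Then the following assertions are equivalent: (1) `L`
is isometric to `L'`; … (4) There are a number `l`, numbers `e_i ∈ {−1, 1}` and a permutation `σ` such that
`p_{σ(i)} ≡ e_i l s_i (mod q)`." "**Theorem 2.2.** … `L` is homotopy equivalent to `L'` if and only if there are numbers `l`
and `e ∈ {−1, 1}` such that `s₁⋯s_n ≡ ±l^n p₁⋯p_n (mod q)`." The tree's `LensWeightsEquivalent q p s` is (4) of Theorem 2.1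
and `LensWeightsHomotopyEquivalent q p s` is the criterion of Theorem 2.2 (`HigherLensSpaceMultiplicity.lean`).

## What is proved

Homotopy equivalence of spaces is an equivalence relation and isometric spaces are homotopy equivalent; this file records the
corresponding direct verifications on the criteria: `LensWeightsHomotopyEquivalent` is reflexive and transitive, symmetric
for weights prime to `q`, and implied by `LensWeightsEquivalent` (taking the product of `p_{σ(i)} ≡ e_i l s_i` over `i`:
`p₁⋯p_n ≡ (∏ e_i) l^n s₁⋯s_n`).

## References

* [Ikeda1980] A. Ikeda, *On lens spaces which are isospectral but not isometric*, Ann. Sci. ÉNS (4) 13 (1980) 303–315,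
  Theorems 2.1, 2.2.
-/

namespace Literature.Analysis.InnerProduct

open Finset

/-- **Reflexivity of the homotopy criterion**: `l = 1`, `e = 1`. [cite: Ikeda1980, Theorem 2.2] -/
theorem LensWeightsHomotopyEquivalent.refl {n : ℕ} (q : ℕ) (p : Fin n → ℤ) : LensWeightsHomotopyEquivalent q p p :=
  ⟨1, 1, Or.inl rfl, by simp⟩

/-- **Transitivity of the homotopy criterion**: `∏ s ≡ e l^n ∏ p`, `∏ t ≡ e' l'^n ∏ s` give `∏ t ≡ (ee')(ll')^n ∏ p`.
[cite: Ikeda1980, Theorem 2.2] -/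
theorem LensWeightsHomotopyEquivalent.trans {n : ℕ} {q : ℕ} {p s t : Fin n → ℤ} (h₁ : LensWeightsHomotopyEquivalent q p s)
    (h₂ : LensWeightsHomotopyEquivalent q s t) : LensWeightsHomotopyEquivalent q p t := by
  obtain ⟨l, e, he, h⟩ := h₁
  obtain ⟨l', e', he', h'⟩ := h₂
  refine ⟨l * l', e * e', ?_, ?_⟩
  · rcases he with rfl | rfl <;> rcases he' with rfl | rfl <;> simp
  · calc ∏ i, t i ≡ e' * l' ^ n * ∏ i, s i [ZMOD q] := h'
      _ ≡ e' * l' ^ n * (e * l ^ n * ∏ i, p i) [ZMOD q] := h.mul_left _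
      _ = e * e' * (l * l') ^ n * ∏ i, p i := by rw [mul_pow]; ring

/-- **Symmetry of the homotopy criterion for weights prime to `q`**: if `∏ s ≡ e l^n ∏ p (mod q)` and the `s_i` are prime to
`q`, then (for `n ≥ 1`) `l` is prime to `q`, and with `ul ≡ 1 (mod q)`: `∏ p ≡ e u^n ∏ s`. [cite: Ikeda1980, Theorem 2.2] -/
theorem LensWeightsHomotopyEquivalent.symm {n : ℕ} {q : ℕ} {p s : Fin n → ℤ} (h : LensWeightsHomotopyEquivalent q p s)
    (hs : ∀ i, IsCoprime (s i) q) : LensWeightsHomotopyEquivalent q s p := by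
  obtain ⟨l, e, he, h⟩ := h
  have he2 : e * e = 1 := by rcases he with rfl | rfl <;> simp
  rcases Nat.eq_zero_or_pos n with hn | hn
  · subst hn
    refine ⟨1, e, he, ?_⟩
    simp only [univ_eq_empty, prod_empty, pow_zero, mul_one] at h ⊢
    exact h
  -- `l` is prime to `q`: `∏ s` is, and `∏ s ≡ e l^n ∏ p`
  have hS : IsCoprime (∏ i, s i) (q : ℤ) := IsCoprime.prod_left fun i _ ↦ hs i
  have hl : IsCoprime l q := by
    obtain ⟨a, b, hab⟩ := hS
    obtain ⟨k, hk⟩ := h.symm.dvd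
    have hln : IsCoprime (l ^ n) q :=
      ⟨a * e * ∏ i, p i, a * k + b, by linear_combination hab - a * hk⟩
    exact (IsCoprime.pow_left_iff hn).mp hln
  obtain ⟨u, v, huv⟩ := hl
  refine ⟨u, e, he, ?_⟩
  -- `∏ p = (e e) ((u l + v q)^n) ∏ p ≡ e u^n (e l^n ∏ p) ≡ e u^n ∏ s`
  have hul : u * l ≡ 1 [ZMOD q] := Int.modEq_iff_dvd.mpr ⟨v, by linear_combination -huv⟩
  calc ∏ i, p i = 1 ^ n * (∏ i, p i) := by rw [one_pow, one_mul]
    _ ≡ (u * l) ^ n * (∏ i, p i) [ZMOD q] := (hul.symm.pow n).mul_right _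
    _ = e * u ^ n * (e * l ^ n * ∏ i, p i) := by linear_combination (-(u ^ n * l ^ n * ∏ i, p i)) * he2 - (mul_pow u l n) * 1
    _ ≡ e * u ^ n * ∏ i, s i [ZMOD q] := h.symm.mul_left _

/-- For weights prime to `q` on both sides the homotopy criterion is symmetric. [cite: Ikeda1980, Theorem 2.2] -/
theorem lensWeightsHomotopyEquivalent_comm {n : ℕ} {q : ℕ} {p s : Fin n → ℤ} (hp : ∀ i, IsCoprime (p i) q)
    (hs : ∀ i, IsCoprime (s i) q) : LensWeightsHomotopyEquivalent q p s ↔ LensWeightsHomotopyEquivalent q s p :=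
  ⟨fun h ↦ h.symm hs, fun h ↦ h.symm hp⟩

/-- **Isometric lens spaces are homotopy equivalent, on the criteria**: if `p_{σ(i)} ≡ e_i l s_i (mod q)` for all `i`
(Theorem 2.1 (4)) then `p₁⋯p_n ≡ (∏ e_i) l^n s₁⋯s_n` (the criterion of Theorem 2.2 for `(s, p)`).
[cite: Ikeda1980, Theorems 2.1, 2.2] -/
theorem LensWeightsEquivalent.lensWeightsHomotopyEquivalent_symm {n : ℕ} {q : ℕ} {p s : Fin n → ℤ}
    (h : LensWeightsEquivalent q p s) : LensWeightsHomotopyEquivalent q s p := by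
  obtain ⟨l, e, he, σ, h⟩ := h
  refine ⟨l, ∏ i, e i, ?_, ?_⟩
  · exact Finset.prod_induction e (fun x ↦ x = 1 ∨ x = -1)
      (fun a b ha hb ↦ by rcases ha with rfl | rfl <;> rcases hb with rfl | rfl <;> simp) (Or.inl rfl) (fun i _ ↦ he i)
  · calc ∏ i, p i = ∏ i, p (σ i) := (Equiv.prod_comp σ p).symm
      _ ≡ ∏ i, (e i * l * s i) [ZMOD q] := Int.ModEq.prod fun i _ ↦ h i
      _ = (∏ i, e i) * l ^ n * ∏ i, s i := by
          rw [prod_mul_distrib, prod_mul_distrib, prod_const, card_univ, Fintype.card_fin]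

/-- **Isometric lens spaces are homotopy equivalent, on the criteria** (weights prime to `q`):
`LensWeightsEquivalent q p s → LensWeightsHomotopyEquivalent q p s`. [cite: Ikeda1980, Theorems 2.1, 2.2] -/
theorem LensWeightsEquivalent.lensWeightsHomotopyEquivalent {n : ℕ} {q : ℕ} {p s : Fin n → ℤ}
    (h : LensWeightsEquivalent q p s) (hp : ∀ i, IsCoprime (p i) q) : LensWeightsHomotopyEquivalent q p s :=
  h.lensWeightsHomotopyEquivalent_symm.symm hp

end Literature.Analysis.InnerProduct
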